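import Mathlib.Analysis.InnerProductSpace.NormPow
import Literature.Analysis.FluidPDE.VorticityDirectionDepletion
import Literature.Analysis.FluidPDE.VorticityHighPart
import HarnessLib

/-!
# The exact pairing of the Biot–Savart gradient with a direction: the triple product

Analysis/FluidPDE proof file (theorems only: no definition, no named fact, no `sorry`).
Search for candidate a priori estimates; no regularity claim (cell `pub-nsfunc`, literature seat:
this file formalises one step of a PUBLISHED proof; nothing new). It is the first brick of the
discharge of `Literature.Analysis.FluidPDE.grujicZhang2006_localized_integral_coherence`
(Grujić–Zhang, Comm. Math. Phys. 262 (2006), Thm. 1.2), whose hypothesis is not a modulus of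
continuity of the vorticity direction `ξ` but a weak-`L^{6/5}` bound on the **triple product**
factor `λ(y) = sup |(ŷ, ξ(x+y,t), ξ(x,t))| / |y|³` ((1.3) of the paper; Constantin–Fefferman's
"`(det(ŷ, ξ(x+y), ξ(x))) |y|⁻³`", Indiana Univ. Math. J. 42 (1993), (2.12)–(2.14)).

The tree's depleted kernel bound `abs_inner_fderiv_biotSavartCLM_apply_le`
(`VorticityDirectionDepletion.lean`) majorises the stretching kernel by the cruder factor
`‖w − ⟪w, e⟫e‖ = |w| |sin ∠(w, e)|`, which the triple product does not control. Here we compute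
the pairing **exactly**: for the Biot–Savart kernel `K(z) h = (4π|z|³)⁻¹ h × z`, `z ≠ 0`, and all
`e, w ∈ ℝ³`,

  `⟪e, (∇K(z) e) w⟫ = −(3 ⟪z, e⟫ / (4π |z|⁵)) ⟪e, w × z⟫`

(`inner_fderiv_biotSavartCLM_apply_eq`; the term `(4π|z|³)⁻¹ ⟪e, w × e⟫` of the product rule
vanishes), whence for a unit vector `e`

  `|⟪e, (∇K(z) e) w⟫| ≤ (3/4π) |⟪z, w × e⟫| / |z|⁴ = (3/4π) |w| |det(ẑ, ŵ, e)| / |z|³`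

(`abs_inner_fderiv_biotSavartCLM_apply_le_triple`) — Constantin–Fefferman's formula (2.13) for
the stretching rate `α = (∇u ξ)·ξ`. Consequences: the stretching rate of the Biot–Savart velocity
of a Hölder continuous compactly supported field `f` at a point where `f ∥ e`, bounded by the
lower Lebesgue integral of the triple-product kernel
(`enorm_inner_fderiv_biotSavart_le_lintegral_triple`), and the form used in the localized
argument of Grujić–Zhang: for the cut-off high part `f = χ w_hi` of a `C¹` field `w` and any
kernel `k ≥ |(x−y, ξ(y), ξ(x))| / |x−y|⁴` on the pairs of high-vorticity points of a set carrying
`χ`, `|⟪w_hi(x), ∇(K ∗ f)(x) w_hi(x)⟫| ≤ (3/4π) |w(x)|² ∫ |f(y)| k(x − y) dy`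
(`enorm_inner_highPart_fderiv_biotSavart_cutoff_le_of_kernel`).

## Mathlib / tree search

Tree (used): `biotSavartCLM`, `biotSavartCLM_apply`, `contDiffAt_biotSavartCLM`
(`BiotSavartGradient.lean`); `inner_self_cross`, `inner_biotSavartKernel_smul_self`,
`inner_fderiv_biotSavartCLM_apply_smul_self`, and the architecture of
`exists_abs_inner_fderiv_biotSavart_le` (`VorticityDirectionDepletion.lean`: gradient formula
`hasFDerivAt_biotSavart`, `integrable_gradIntegrand`, the cutoff term drops out);
`highPart_eq_smul_vorticityDirection`, `lt_norm_of_highPart_ne_zero` (`VorticityHighPart.lean`).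
Mathlib: `hasFDerivAt_norm_rpow` (derivative of `|z|^p`), `hasFDerivAt_inv`, `HasFDerivAt.mul`,
`HasFDerivAt.unique`, `enorm_integral_le_lintegral_enorm`. `lean search` for
`triple product|det.*cross|inner_cross`: only `Literature.Analysis.VectorCalculus.cross` and its
`crossCLM`; no exact formula for the Biot–Savart gradient pairing in the tree.

## References

* P. Constantin, C. Fefferman, *Direction of vorticity and the problem of global regularity for
  the Navier–Stokes equations*, Indiana Univ. Math. J. 42 (1993) 775–789, §2, (2.12)–(2.14).
  [ConstantinFeffermanIndiana1993]
* Z. Grujić, Qi S. Zhang, *Space-time localization of a class of geometric criteria for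
  preventing blow-up in the 3D NSE*, Comm. Math. Phys. 262 (2006) 555–564, (1.3) and the proof of
  Thm. 1.2 (p. 563: "`|α₁(x,t)| ≤ c ∫_{|y|≤r} K(y) |ω(x+y,t)| dy`"). [GrujicZhang2006]
-/

noncomputable section

open MeasureTheory Set Function Filter Metric Real InnerProductSpace
open _root_.Topology
open scoped ENNReal NNReal RealInnerProductSpace

namespace Literature.Analysis.FluidPDE

/-! ### Algebra of the triple product -/

/-- `⟪e, w × e⟫ = 0` (the triple product with a repeated entry). [folklore] -/
private theorem inner_cross_left_self (e w : (EuclideanSpace ℝ (Fin 3))) : ⟪e, cross w e⟫ = 0 := by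
  simp only [cross, PiLp.inner_apply, RCLike.inner_apply, conj_trivial, Fin.sum_univ_three,
    cross_apply, Matrix.cons_val_zero, Matrix.cons_val_one, Matrix.cons_val_two,
    Matrix.head_cons, Matrix.tail_cons]
  ring

/-- Antisymmetry of the triple product in its outer entries: `⟪e, w × z⟫ = −⟪z, w × e⟫`. [folklore] -/
private theorem inner_cross_swap (e w z : (EuclideanSpace ℝ (Fin 3))) : ⟪e, cross w z⟫ = -⟪z, cross w e⟫ := by
  simp only [cross, PiLp.inner_apply, RCLike.inner_apply, conj_trivial, Fin.sum_univ_three,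
    cross_apply, Matrix.cons_val_zero, Matrix.cons_val_one, Matrix.cons_val_two,
    Matrix.head_cons, Matrix.tail_cons]
  ring

/-- Homogeneity of the triple product in the middle entry: `⟪z, (a • v) × e⟫ = a ⟪z, v × e⟫`. [folklore] -/
private theorem inner_cross_smul_left (z v e : (EuclideanSpace ℝ (Fin 3))) (a : ℝ) :
    ⟪z, cross (a • v) e⟫ = a * ⟪z, cross v e⟫ := by
  rw [← crossCLM_apply, ← crossCLM_apply, map_smul, smul_apply,
    real_inner_smul_right]

/-! ### The exact pairing `⟪e, (∇K(z) e) w⟫` -/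

/-- **The stretching kernel, exactly** (Constantin–Fefferman 1993, (2.13)): for the Biot–Savart
kernel `K(z) h = (4π|z|³)⁻¹ h × z`, `z ≠ 0`, and all `e, w`,
`⟪e, (∇K(z) e) w⟫ = −(3⟪z, e⟫ / (4π|z|⁵)) ⟪e, w × z⟫`: differentiating the scalar function
`z ↦ ⟪e, K(z) w⟫ = (4π|z|³)⁻¹ ⟪e, w × z⟫` in the direction `e`, the derivative of the linear factor
is `⟪e, w × e⟫ = 0`. [cite: ConstantinFeffermanIndiana1993, §2 (2.13)] -/
theorem inner_fderiv_biotSavartCLM_apply_eq {z : (EuclideanSpace ℝ (Fin 3))} (hz : z ≠ 0)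
    (e w : (EuclideanSpace ℝ (Fin 3))) :
    ⟪e, (fderiv ℝ biotSavartCLM z e) w⟫ = -(3 * ⟪z, e⟫ / (4 * π * ‖z‖ ^ 5)) * ⟪e, cross w z⟫ := by
  have hd : DifferentiableAt ℝ biotSavartCLM z :=
    (contDiffAt_biotSavartCLM hz (n := 1)).differentiableAt one_ne_zero
  -- the continuous linear functional `ℓ L = ⟪e, L w⟫` on `ℝ³ →L[ℝ] ℝ³`
  set ℓ : ((EuclideanSpace ℝ (Fin 3)) →L[ℝ] (EuclideanSpace ℝ (Fin 3))) →L[ℝ] ℝ :=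
    (innerSL ℝ e).comp (ContinuousLinearMap.apply ℝ (EuclideanSpace ℝ (Fin 3)) w) with hℓ
  have hℓapp : ∀ L : (EuclideanSpace ℝ (Fin 3)) →L[ℝ] (EuclideanSpace ℝ (Fin 3)), ℓ L = ⟪e, L w⟫ :=
    fun L => by
      simp only [hℓ, ContinuousLinearMap.comp_apply, ContinuousLinearMap.apply_apply, innerSL_apply_apply]
  -- the linear factor `L_w z' = ⟪e, w × z'⟫` and the scalar factor `c z' = 4π|z'|³`
  set Lw : (EuclideanSpace ℝ (Fin 3)) →L[ℝ] ℝ := (innerSL ℝ e).comp (crossCLM w) with hLw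
  have hLwapp : ∀ z' : (EuclideanSpace ℝ (Fin 3)), Lw z' = ⟪e, cross w z'⟫ := fun z' => by
    simp only [hLw, ContinuousLinearMap.comp_apply, innerSL_apply_apply, crossCLM_apply]
  set cz : (EuclideanSpace ℝ (Fin 3)) → ℝ := fun z' => 4 * π * ‖z'‖ ^ 3 with hcz
  have hφ : (fun z' => ℓ (biotSavartCLM z')) = fun z' => (cz z')⁻¹ * Lw z' := by
    funext z'
    rw [hℓapp, biotSavartCLM_apply, biotSavartKernel, real_inner_smul_right, hLwapp]
  -- derivative of `|z'|³` and of `(4π|z'|³)⁻¹`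
  have hn3 : HasFDerivAt (fun z' : (EuclideanSpace ℝ (Fin 3)) => ‖z'‖ ^ 3) ((3 * ‖z‖) • innerSL ℝ z) z := by
    have h := hasFDerivAt_norm_rpow z (by norm_num : (1 : ℝ) < 3)
    rw [show (3 : ℝ) - 2 = 1 by norm_num, Real.rpow_one] at h
    refine h.congr_of_eventuallyEq (Eventually.of_forall fun y => ?_)
    exact_mod_cast (Real.rpow_natCast ‖y‖ 3).symm
  have hc : HasFDerivAt cz ((4 * π) • ((3 * ‖z‖) • innerSL ℝ z)) z := hn3.const_mul (4 * π)
  have hzn : 0 < ‖z‖ := norm_pos_iff.2 hz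
  have hcz0 : cz z ≠ 0 := by simp only [hcz]; positivity
  have hinv : HasFDerivAt (fun z' => (cz z')⁻¹)
      ((ContinuousLinearMap.toSpanSingleton ℝ (-(cz z ^ 2)⁻¹)).comp
        ((4 * π) • ((3 * ‖z‖) • innerSL ℝ z))) z :=
    (hasFDerivAt_inv hcz0).comp z hc
  have hprod : HasFDerivAt (fun z' => (cz z')⁻¹ * Lw z')
      ((cz z)⁻¹ • Lw + Lw z • (ContinuousLinearMap.toSpanSingleton ℝ (-(cz z ^ 2)⁻¹)).comp
        ((4 * π) • ((3 * ‖z‖) • innerSL ℝ z))) z :=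
    hinv.mul Lw.hasFDerivAt
  -- the chain rule for `ℓ ∘ K` and uniqueness of the derivative
  have h1 : HasFDerivAt (fun z' => ℓ (biotSavartCLM z')) (ℓ.comp (fderiv ℝ biotSavartCLM z)) z :=
    ℓ.hasFDerivAt.comp z hd.hasFDerivAt
  rw [hφ] at h1
  have heq := h1.unique hprod
  have happ := congrArg (fun L : (EuclideanSpace ℝ (Fin 3)) →L[ℝ] ℝ => L e) heq
  simp only [ContinuousLinearMap.comp_apply, add_apply,
    smul_apply, ContinuousLinearMap.toSpanSingleton_apply, innerSL_apply_apply,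
    smul_eq_mul] at happ
  rw [hℓapp, hLwapp, hLwapp, inner_cross_left_self, mul_zero, zero_add] at happ
  rw [happ]
  simp only [hcz]
  field_simp

/-- **The depleted kernel bound by the triple product** (Constantin–Fefferman 1993, (2.13)–(2.14):
`|α| ≤ (3/4π) P.V.∫ |det(ŷ, ξ(x+y), ξ(x))| |ω(x+y)| dy/|y|³`): for a unit vector `e`, `z ≠ 0` and any
`w`, `|⟪e, (∇K(z) e) w⟫| ≤ (3/4π) |⟪z, w × e⟫| / |z|⁴`. [cite: ConstantinFeffermanIndiana1993, §2 (2.13)–(2.14)] -/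
theorem abs_inner_fderiv_biotSavartCLM_apply_le_triple {z : (EuclideanSpace ℝ (Fin 3))} (hz : z ≠ 0)
    {e : (EuclideanSpace ℝ (Fin 3))} (he : ‖e‖ = 1) (w : (EuclideanSpace ℝ (Fin 3))) :
    |⟪e, (fderiv ℝ biotSavartCLM z e) w⟫| ≤ 3 / (4 * π) * (|⟪z, cross w e⟫| / ‖z‖ ^ 4) := by
  have hzn : 0 < ‖z‖ := norm_pos_iff.2 hz
  rw [inner_fderiv_biotSavartCLM_apply_eq hz, inner_cross_swap e w z,
    show -(3 * ⟪z, e⟫ / (4 * π * ‖z‖ ^ 5)) * -⟪z, cross w e⟫ =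
      3 / (4 * π * ‖z‖ ^ 5) * (⟪z, e⟫ * ⟪z, cross w e⟫) by ring,
    abs_mul, abs_of_pos (by positivity : (0 : ℝ) < 3 / (4 * π * ‖z‖ ^ 5)), abs_mul]
  have hze : |⟪z, e⟫| ≤ ‖z‖ := (abs_real_inner_le_norm z e).trans (by rw [he, mul_one])
  calc 3 / (4 * π * ‖z‖ ^ 5) * (|⟪z, e⟫| * |⟪z, cross w e⟫|)
      ≤ 3 / (4 * π * ‖z‖ ^ 5) * (‖z‖ * |⟪z, cross w e⟫|) := by gcongr
    _ = 3 / (4 * π) * (|⟪z, cross w e⟫| / ‖z‖ ^ 4) := by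
        field_simp

/-! ### The stretching rate of a Biot–Savart velocity bounded by the triple-product integral -/

/-- **Geometric depletion by the triple product** (Constantin–Fefferman 1993, (2.13)–(2.14);
Grujić–Zhang 2006, proof of Thm. 1.2). If `f : ℝ³ → ℝ³` is `γ`-Hölder (`γ > 0`) with compact
support, `e` is a unit vector and `f(x)` is parallel to `e`, then the stretching rate of the
Biot–Savart velocity `v = K ∗ f` at `x` in the direction `e` satisfies
`|⟪e, Dv(x) e⟫| ≤ ∫ (3/4π) |⟪x − y, f(y) × e⟫| / |x − y|⁴ dy` (a lower Lebesgue integral; no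
integrability of the majorant is needed). Proof: the gradient formula `hasFDerivAt_biotSavart`,
`Dv(x)e = ∫(∇K(x−y)e)(f y − χ(y) f x) dy + ∫ ∂ₑχ(y) K(x−y) f(x) dy`; pairing with `e` kills `f x`
everywhere, and `|⟪e, (∇K(x−y)e)(f y)⟫|` is bounded by `abs_inner_fderiv_biotSavartCLM_apply_le_triple`. [cite: ConstantinFeffermanIndiana1993, §2 (2.13)–(2.14); GrujicZhang2006, Thm. 1.2 (proof, p. 563)] -/
theorem enorm_inner_fderiv_biotSavart_le_lintegral_triple {γ C : ℝ≥0} (hγ : 0 < γ)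
    {f : (EuclideanSpace ℝ (Fin 3)) → (EuclideanSpace ℝ (Fin 3))} (hf : HolderWith C γ f)
    (hfc : HasCompactSupport f) {x e : (EuclideanSpace ℝ (Fin 3))} (he : ‖e‖ = 1)
    (hpar : ∃ c : ℝ, f x = c • e) :
    ‖⟪e, fderiv ℝ (biotSavart f) x e⟫‖ₑ ≤
      ∫⁻ y, ENNReal.ofReal (3 / (4 * π) * (|⟪x - y, cross (f y) e⟫| / ‖x - y‖ ^ 4)) := by
  obtain ⟨A, hK⟩ := exists_isC1SingularKernel_biotSavartCLM
  obtain ⟨c, hc⟩ := hpar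
  -- a ball around `x` containing the support
  obtain ⟨R, hR⟩ := hfc.isCompact.isBounded.subset_closedBall (0 : (EuclideanSpace ℝ (Fin 3)))
  set ρ : ℝ := |R| + ‖x‖ + 1 with hρdef
  have hρ : 0 < ρ := by positivity
  have hsupp : tsupport f ⊆ closedBall x ρ := by
    intro y hy
    have hy' : ‖y‖ ≤ R := mem_closedBall_zero_iff.1 (hR hy)
    rw [mem_closedBall, dist_eq_norm]
    calc ‖y - x‖ ≤ ‖y‖ + ‖x‖ := norm_sub_le _ _
      _ ≤ |R| + ‖x‖ + 1 := by linarith [le_abs_self R]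
  have hx : ‖x - x‖ < ρ / 2 := by rw [sub_self, norm_zero]; positivity
  -- the gradient formula
  have hD : fderiv ℝ (biotSavart f) x = gradPotential biotSavartCLM x ρ f x :=
    (hasFDerivAt_biotSavart hγ hf hρ hsupp hx).fderiv
  set F₁ : (EuclideanSpace ℝ (Fin 3)) → (EuclideanSpace ℝ (Fin 3)) →L[ℝ] (EuclideanSpace ℝ (Fin 3)) := fun y =>
    (fderiv ℝ biotSavartCLM (x - y)).flip (f y - suppCutoff x ρ y • f x) with hF₁
  set F₂ : (EuclideanSpace ℝ (Fin 3)) → (EuclideanSpace ℝ (Fin 3)) →L[ℝ] (EuclideanSpace ℝ (Fin 3)) := fun y =>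
    (fderiv ℝ (suppCutoff x ρ) y).smulRight (biotSavartCLM (x - y) (f x)) with hF₂
  have hgrad : gradPotential biotSavartCLM x ρ f x = (∫ y, F₁ y) + ∫ y, F₂ y := rfl
  have hF₁i : Integrable F₁ := integrable_gradIntegrand hK hγ hf hρ hsupp hx
  -- the cutoff term drops out
  have h2 : ⟪e, (∫ y, F₂ y) e⟫ = 0 := by
    by_cases hF₂i : Integrable F₂
    · rw [ContinuousLinearMap.integral_apply hF₂i, ← integral_inner (hF₂i.apply_continuousLinearMap e)]
      refine integral_eq_zero_of_ae (Eventually.of_forall fun y => ?_)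
      simp only [hF₂, ContinuousLinearMap.smulRight_apply, real_inner_smul_right, biotSavartCLM_apply,
        hc, inner_biotSavartKernel_smul_self, mul_zero, Pi.zero_apply]
    · rw [integral_undef hF₂i, zero_apply, inner_zero_right]
  -- the singular term: pointwise identification off the diagonal and the triple-product bound
  have hpt : ∀ y, y ≠ x → ⟪e, F₁ y e⟫ = ⟪e, (fderiv ℝ biotSavartCLM (x - y) e) (f y)⟫ := by
    intro y hy
    have hz : x - y ≠ 0 := sub_ne_zero.2 (Ne.symm hy)
    show ⟪e, ((fderiv ℝ biotSavartCLM (x - y)).flip (f y - suppCutoff x ρ y • f x)) e⟫ = _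
    rw [ContinuousLinearMap.flip_apply, map_sub, map_smul, inner_sub_right, real_inner_smul_right, hc,
      inner_fderiv_biotSavartCLM_apply_smul_self hz, mul_zero, sub_zero]
  have hae : ∀ᵐ y ∂(volume : Measure (EuclideanSpace ℝ (Fin 3))),
      ‖⟪e, F₁ y e⟫‖ₑ ≤ ENNReal.ofReal (3 / (4 * π) * (|⟪x - y, cross (f y) e⟫| / ‖x - y‖ ^ 4)) := by
    have hne : ∀ᵐ y ∂(volume : Measure (EuclideanSpace ℝ (Fin 3))), y ≠ x := by
      simp [ae_iff, measure_singleton]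
    filter_upwards [hne] with y hy
    rw [hpt y hy, Real.enorm_eq_ofReal_abs]
    exact ENNReal.ofReal_le_ofReal
      (abs_inner_fderiv_biotSavartCLM_apply_le_triple (sub_ne_zero.2 (Ne.symm hy)) he (f y))
  have h1 : ‖⟪e, (∫ y, F₁ y) e⟫‖ₑ ≤
      ∫⁻ y, ENNReal.ofReal (3 / (4 * π) * (|⟪x - y, cross (f y) e⟫| / ‖x - y‖ ^ 4)) := by
    rw [ContinuousLinearMap.integral_apply hF₁i, ← integral_inner (hF₁i.apply_continuousLinearMap e)]
    exact (enorm_integral_le_lintegral_enorm _).trans (lintegral_mono_ae hae)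
  -- assemble
  rw [hD, hgrad, _root_.add_apply, inner_add_right, h2, add_zero]
  exact h1

/-! ### The cut-off high part: kernels dominating the triple product of the directions -/

/-- **Depleted self-stretching of the cut-off high vorticity, triple-product form** (Grujić–Zhang
2006, proof of Thm. 1.2: "`|α₁(x,t)| ≤ c ∫_{|y|≤r} K(y)|ω(x+y,t)| dy`", with Constantin–Fefferman's
(2.13)). For a `C¹` field `w`, its high part `w_hi = (1 − θ_R(w)) w` (`R > 0`), a threshold
`Ω ≤ R`, a `C¹` compactly supported weight `χ ≥ 0` supported inside a set `O`, and any kernel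
`k : ℝ³ → [0, ∞]` dominating the triple product of the directions `ξ = w/|w|`,
`|⟪x − y, ξ(y) × ξ(x)⟫| / |x − y|⁴ ≤ k(x − y)` for all pairs `x, y ∈ O` with `|w(x)|, |w(y)| > Ω`,
one has at every `x ∈ O`, with `f = χ w_hi`,
`|⟪w_hi(x), ∇(K ∗ f)(x) w_hi(x)⟫| ≤ (3/4π) |w(x)|² ∫ |f(y)| k(x − y) dy` (lower Lebesgue integral).
Proof: `enorm_inner_fderiv_biotSavart_le_lintegral_triple` with `e = ξ(x)` (to which `w_hi(x)` and
`f(x)` are parallel) and `⟪x − y, f(y) × e⟫ = |f(y)| ⟪x − y, ξ(y) × ξ(x)⟫`. [cite: GrujicZhang2006, Thm. 1.2 (proof, p. 563); ConstantinFeffermanIndiana1993, §2 (2.13)–(2.14)] -/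
theorem enorm_inner_highPart_fderiv_biotSavart_cutoff_le_of_kernel
    {w : (EuclideanSpace ℝ (Fin 3)) → (EuclideanSpace ℝ (Fin 3))} (hw : ContDiff ℝ 1 w)
    {R Ω : ℝ} (hR : 0 < R) (hΩR : Ω ≤ R)
    {χ : (EuclideanSpace ℝ (Fin 3)) → ℝ} (hχ : ContDiff ℝ 1 χ) (hχc : HasCompactSupport χ)
    (hχ0 : ∀ y, 0 ≤ χ y) {O : Set (EuclideanSpace ℝ (Fin 3))} (hχO : support χ ⊆ O)
    {k : (EuclideanSpace ℝ (Fin 3)) → ℝ≥0∞}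
    (hdir : ∀ x ∈ O, ∀ y ∈ O, Ω < ‖w x‖ → Ω < ‖w y‖ →
      ENNReal.ofReal (|⟪x - y, cross (vorticityDirection w y) (vorticityDirection w x)⟫| /
          ‖x - y‖ ^ 4) ≤ k (x - y))
    {x : (EuclideanSpace ℝ (Fin 3))} (hxO : x ∈ O) :
    ‖⟪(1 - radialCutoff R (2 * R) (w x)) • w x,
        fderiv ℝ (biotSavart fun y => χ y • ((1 - radialCutoff R (2 * R) (w y)) • w y)) x
          ((1 - radialCutoff R (2 * R) (w x)) • w x)⟫‖ₑ ≤
      ENNReal.ofReal (3 / (4 * π) * ‖w x‖ ^ 2) *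
        ∫⁻ y, ‖χ y • ((1 - radialCutoff R (2 * R) (w y)) • w y)‖ₑ * k (x - y) := by
  set hi : (EuclideanSpace ℝ (Fin 3)) → (EuclideanSpace ℝ (Fin 3)) :=
    fun y => (1 - radialCutoff R (2 * R) (w y)) • w y with hhi
  set f : (EuclideanSpace ℝ (Fin 3)) → (EuclideanSpace ℝ (Fin 3)) := fun y => χ y • hi y with hf
  have hhi1 : ContDiff ℝ 1 hi := contDiff_highPart hw R
  have hf1 : ContDiff ℝ 1 f := hχ.smul hhi1
  have hfc : HasCompactSupport f := hχc.smul_right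
  show ‖⟪hi x, fderiv ℝ (biotSavart f) x (hi x)⟫‖ₑ ≤
    ENNReal.ofReal (3 / (4 * π) * ‖w x‖ ^ 2) * ∫⁻ y, ‖f y‖ₑ * k (x - y)
  by_cases hx : hi x = 0
  · rw [hx, inner_zero_left, enorm_zero]
    exact bot_le
  -- the direction at `x`
  have hwR : R < ‖w x‖ := lt_norm_of_highPart_ne_zero hR hx
  have hw0 : w x ≠ 0 := by
    intro h; rw [h, norm_zero] at hwR; exact lt_irrefl _ (hR.trans hwR)
  have hxΩ : Ω < ‖w x‖ := hΩR.trans_lt hwR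
  set e : (EuclideanSpace ℝ (Fin 3)) := vorticityDirection w x with he
  have he1 : ‖e‖ = 1 := norm_vorticityDirection w hw0
  set c : ℝ := (1 - radialCutoff R (2 * R) (w x)) * ‖w x‖ with hc
  have hhix : hi x = c • e := highPart_eq_smul_vorticityDirection w R x
  have hc0 : 0 ≤ c := mul_nonneg (sub_nonneg.2 (radialCutoff_le_one _ _ _)) (norm_nonneg _)
  have hcle : c ≤ ‖w x‖ :=
    mul_le_of_le_one_left (norm_nonneg _) (sub_le_self _ (radialCutoff_nonneg _ _ _))
  have hfx : f x = (χ x * c) • e := by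
    show χ x • hi x = (χ x * c) • e
    rw [hhix, smul_smul]
  -- Hölder continuity of `f`
  obtain ⟨Cl, hCl⟩ := hf1.lipschitzWith_of_hasCompactSupport hfc one_ne_zero
  have hhol : HolderWith Cl 1 f := hCl.holderWith
  have hkey := enorm_inner_fderiv_biotSavart_le_lintegral_triple one_pos hhol hfc he1 ⟨χ x * c, hfx⟩
  -- the pointwise domination of the triple-product kernel
  have hdom : ∀ y, ENNReal.ofReal (3 / (4 * π) * (|⟪x - y, cross (f y) e⟫| / ‖x - y‖ ^ 4)) ≤
      ENNReal.ofReal (3 / (4 * π)) * (‖f y‖ₑ * k (x - y)) := by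
    intro y
    -- `f y = (χ y c_y) • ξ(y)` with `χ y c_y = |f y|` when `w y ≠ 0`
    set cy : ℝ := (1 - radialCutoff R (2 * R) (w y)) * ‖w y‖ with hcy
    have hcy0 : 0 ≤ cy := mul_nonneg (sub_nonneg.2 (radialCutoff_le_one _ _ _)) (norm_nonneg _)
    have hfy : f y = (χ y * cy) • vorticityDirection w y := by
      show χ y • hi y = (χ y * cy) • vorticityDirection w y
      rw [hhi]; simp only
      rw [highPart_eq_smul_vorticityDirection w R y, smul_smul]
    by_cases hhy : hi y = 0
    · have hfy0 : f y = 0 := by show χ y • hi y = 0; rw [hhy, smul_zero]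
      rw [hfy0]
      simp [cross, WithLp.ofLp_zero, inner_zero_right]
    have hwyR : R < ‖w y‖ := lt_norm_of_highPart_ne_zero hR hhy
    have hwy0 : w y ≠ 0 := by
      intro h; rw [h, norm_zero] at hwyR; exact lt_irrefl _ (hR.trans hwyR)
    have hyΩ : Ω < ‖w y‖ := hΩR.trans_lt hwyR
    have hnfy : ‖f y‖ = χ y * cy := by
      rw [hfy, norm_smul, norm_vorticityDirection w hwy0, mul_one, Real.norm_eq_abs,
        abs_of_nonneg (mul_nonneg (hχ0 y) hcy0)]
    by_cases hχy : χ y = 0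
    · have hfy0 : f y = 0 := by show χ y • hi y = 0; rw [hχy, zero_smul]
      rw [hfy0]
      simp [cross, WithLp.ofLp_zero, inner_zero_right]
    have hyO : y ∈ O := hχO (mem_support.2 hχy)
    have htrip : |⟪x - y, cross (f y) e⟫| =
        ‖f y‖ * |⟪x - y, cross (vorticityDirection w y) (vorticityDirection w x)⟫| := by
      rw [hnfy, hfy, inner_cross_smul_left, abs_mul, abs_of_nonneg (mul_nonneg (hχ0 y) hcy0)]
    rw [htrip, mul_div_assoc, ENNReal.ofReal_mul (by positivity : (0 : ℝ) ≤ 3 / (4 * π)),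
      ENNReal.ofReal_mul (norm_nonneg _), ofReal_norm]
    exact mul_le_mul' le_rfl (mul_le_mul' le_rfl (hdir x hxO y hyO hxΩ hyΩ))
  -- assemble
  have hinner : ⟪hi x, fderiv ℝ (biotSavart f) x (hi x)⟫ =
      c ^ 2 * ⟪e, fderiv ℝ (biotSavart f) x e⟫ := by
    rw [hhix, map_smul, real_inner_smul_left, real_inner_smul_right]
    ring
  have hmeas_f : ∫⁻ y, ENNReal.ofReal (3 / (4 * π) * (|⟪x - y, cross (f y) e⟫| / ‖x - y‖ ^ 4)) ≤
      ENNReal.ofReal (3 / (4 * π)) * ∫⁻ y, ‖f y‖ₑ * k (x - y) := by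
    calc ∫⁻ y, ENNReal.ofReal (3 / (4 * π) * (|⟪x - y, cross (f y) e⟫| / ‖x - y‖ ^ 4))
        ≤ ∫⁻ y, ENNReal.ofReal (3 / (4 * π)) * (‖f y‖ₑ * k (x - y)) := lintegral_mono hdom
      _ = ENNReal.ofReal (3 / (4 * π)) * ∫⁻ y, ‖f y‖ₑ * k (x - y) :=
          lintegral_const_mul' _ _ ENNReal.ofReal_ne_top
  rw [hinner, enorm_mul, Real.enorm_eq_ofReal_abs, abs_of_nonneg (sq_nonneg c)]
  have hc2 : ENNReal.ofReal (c ^ 2) ≤ ENNReal.ofReal (‖w x‖ ^ 2) :=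
    ENNReal.ofReal_le_ofReal (pow_le_pow_left₀ hc0 hcle 2)
  calc ENNReal.ofReal (c ^ 2) * ‖⟪e, fderiv ℝ (biotSavart f) x e⟫‖ₑ
      ≤ ENNReal.ofReal (‖w x‖ ^ 2) * (ENNReal.ofReal (3 / (4 * π)) * ∫⁻ y, ‖f y‖ₑ * k (x - y)) :=
        mul_le_mul' hc2 (hkey.trans hmeas_f)
    _ = ENNReal.ofReal (3 / (4 * π) * ‖w x‖ ^ 2) * ∫⁻ y, ‖f y‖ₑ * k (x - y) := by
        rw [← mul_assoc, ← ENNReal.ofReal_mul (by positivity : (0 : ℝ) ≤ ‖w x‖ ^ 2), mul_comm (‖w x‖ ^ 2)]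

end Literature.Analysis.FluidPDE

end
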